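import Summits.MatrixMultiplication.OmegaCensus.SmallFormats.MatMul22nDeflationPair
import Summits.MatrixMultiplication.OmegaCensus.SmallFormats.MatMul22nGramNondeg
import Summits.MatrixMultiplication.OmegaCensus.SmallFormats.MatMul22nRowSubcomp
import HarnessLib

/-!
# ω-census family (a): the DOUBLE-CELL KILL — a double cell whose row and column are loaded with single neighbours yields an admissible deflation killing three terms (any field)

Cell `pub-omega` (unit `pub-omega-tensor`, gen 40), topic `Summits/MatrixMultiplication/OmegaCensus` (sub-folder
`SmallFormats`). Framing (verbatim): lottery ticket; floor = certified bounds/negative ranges. HONEST FRAMING: §7(c) of tensor g40's memo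
DEFLATION-g40 as a general structural theorem (any field, `n + 1 ≥ 8`, length `≤ 3(n+1)+3`): plumbing lemmas (pairing identities, the
recombination of two terms with the same X-form) and the kill theorem `DoubleCellKill.exists_deflation`. Consumed by the M2 file. Nothing here is a bound on `ω`.
-/

namespace Summit.MatrixMultiplication.OmegaCensus.SmallFormats

open Finset Module Matrix
open Literature.Computability.AlgebraicComplexity
open Summit.MatrixMultiplication.OmegaCensus.RankOnePlaneCapGeneral

namespace DoubleCellKill

variable {k : Type*} [Field k] {n : ℕ} {ι : Type*} [Fintype ι]

/-- A Y-form evaluated at an outer product `ν xᵀ` is the pairing of the `ν`-combination of its coefficient rows with `x`. -/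
theorem g_vecMulVec_eq_combo_dot (β : BilinComp (mulBilin k 2 2 n) ι) (t : ι) (ν : Fin 2 → k) (x : Fin n → k) :
    β.g t (Matrix.vecMulVec ν x) = (∑ κ, ν κ • (fun j => β.g t (Matrix.single κ j (1 : k)))) ⬝ᵥ x := by
  rw [CheapSpans.g_vecMulVec_eq_sum]
  simp only [dotProduct, Matrix.vecMul, Finset.sum_apply, Pi.smul_apply, smul_eq_mul, Matrix.of_apply]
  exact Finset.sum_congr rfl fun i _ => mul_comm _ _

/-- A Y-form in terms of its coefficient rows: `g_t(Y) = ∑_{q,j} g_t(E_{qj}) · Y q j`. -/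
theorem g_eq_sum_rows (β : BilinComp (mulBilin k 2 2 n) ι) (t : ι) (Y : Matrix (Fin 2) (Fin n) k) :
    β.g t Y = ∑ q, ∑ j, (fun j => β.g t (Matrix.single q j (1 : k))) j * Y q j := by
  rw [dual_apply_eq_sum_single (β.g t) Y]
  exact Finset.sum_congr rfl fun q _ => Finset.sum_congr rfl fun j _ => by rw [mul_comm]

omit [Fintype ι] in
/-- The cheap-output pairing of an output matrix: `∑_i c i (ν ᵥ* W)_i = (∑_κ ν κ • W κ) ⬝ᵥ c`. -/
theorem cheapOut_eq_combo_dot (W : Matrix (Fin 2) (Fin n) k) (ν : Fin 2 → k) (c : Fin n → k) :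
    (∑ i, c i * (Matrix.vecMul ν W) i) = (∑ κ, ν κ • W κ) ⬝ᵥ c := by
  simp only [dotProduct, Matrix.vecMul, Finset.sum_apply, Pi.smul_apply, smul_eq_mul]
  exact Finset.sum_congr rfl fun i _ => mul_comm _ _

omit [Fintype ι] in
/-- In `k²`: a vector orthogonal to two linearly independent vectors is zero. -/
theorem eq_zero_of_perp_indep (ν₂ ν₃ η : Fin 2 → k) (hind : ∀ a b : k, a • ν₂ + b • ν₃ = 0 → a = 0 ∧ b = 0)
    (h₂ : ν₂ ⬝ᵥ η = 0) (h₃ : ν₃ ⬝ᵥ η = 0) : η = 0 := by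
  by_contra hη
  obtain ⟨a₁, a₂, hne, hrel⟩ := GramNondeg.exists_combo_of_perp η ν₂ ν₃ hη h₂ h₃
  have h0 : a₁ • ν₂ + a₂ • ν₃ = 0 := by
    funext m; simpa using hrel m
  obtain ⟨e₁, e₂⟩ := hind a₁ a₂ h0
  rcases hne with h | h
  · exact h e₁
  · exact h e₂

omit [Fintype ι] in
/-- `ν = (−λ₁, λ₀)`-vectors of independent `λ`'s are independent. -/
theorem nu_indep (lam lam' : Fin 2 → k) (hind : ∀ a b : k, a • lam + b • lam' = 0 → a = 0 ∧ b = 0) :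
    ∀ a b : k, a • (![-lam 1, lam 0] : Fin 2 → k) + b • (![-lam' 1, lam' 0] : Fin 2 → k) = 0 → a = 0 ∧ b = 0 := by
  intro a b h
  have h0 := congrFun h 0
  have h1 := congrFun h 1
  simp at h0 h1
  refine hind a b ?_
  funext i; fin_cases i
  · simpa using h1
  · simp; linear_combination -h0

/-- **Recombining a double cell.** Two distinct terms `d₁ ≠ d₂` with the same X-form may be replaced by
`(x g₁ + y g₂, x⁻¹ w₁), (g₂, w₂ − y x⁻¹ w₁)` (if `x ≠ 0`; symmetrically if `y ≠ 0`): a computation of the same map with the same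
X-forms, unchanged outside `{d₁, d₂}`, in which one of the two terms has Y-form `x g_{d₁} + y g_{d₂}`. -/
theorem exists_recombine {U V W : Type*} [AddCommGroup U] [Module k U] [AddCommGroup V] [Module k V] [AddCommGroup W]
    [Module k W] {φ : U →ₗ[k] V →ₗ[k] W} [DecidableEq ι] (β : BilinComp φ ι) (d₁ d₂ : ι) (hne : d₁ ≠ d₂)
    (hf : β.f d₁ = β.f d₂) (x y : k) (hxy : x ≠ 0 ∨ y ≠ 0) :
    ∃ (β' : BilinComp φ ι) (d : ι), (d = d₁ ∨ d = d₂) ∧ β'.f = β.f ∧ β'.g d = x • β.g d₁ + y • β.g d₂ ∧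
      (∀ i, i ≠ d₁ → i ≠ d₂ → β'.g i = β.g i ∧ β'.w i = β.w i) := by
  classical
  -- the generic construction for `x ≠ 0`, applied to (d₁,d₂,x,y) or to (d₂,d₁,y,x)
  have key : ∀ (e₁ e₂ : ι), e₁ ≠ e₂ → β.f e₁ = β.f e₂ → ∀ a b : k, a ≠ 0 →
      ∃ β' : BilinComp φ ι, β'.f = β.f ∧ β'.g e₁ = a • β.g e₁ + b • β.g e₂ ∧
        (∀ i, i ≠ e₁ → i ≠ e₂ → β'.g i = β.g i ∧ β'.w i = β.w i) := by
    intro e₁ e₂ hne' hf' a b ha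
    refine ⟨{ f := β.f
              g := Function.update β.g e₁ (a • β.g e₁ + b • β.g e₂)
              w := Function.update (Function.update β.w e₁ (a⁻¹ • β.w e₁)) e₂ (β.w e₂ - (b * a⁻¹) • β.w e₁)
              map_eq_sum := fun u v => ?_ }, rfl, by simp, fun i hi₁ hi₂ => ⟨by simp [hi₁], by simp [hi₁, hi₂]⟩⟩
    rw [β.map_eq_sum]
    -- split off e₁ and e₂ from both sums
    have he₂ : e₂ ∈ Finset.univ.erase e₁ := Finset.mem_erase.mpr ⟨hne'.symm, Finset.mem_univ _⟩
    rw [← Finset.add_sum_erase _ _ (Finset.mem_univ e₁), ← Finset.add_sum_erase _ _ he₂,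
      ← Finset.add_sum_erase _ _ (Finset.mem_univ e₁), ← Finset.add_sum_erase _ _ he₂]
    have htail : ∑ i ∈ (Finset.univ.erase e₁).erase e₂,
        (β.f i u * Function.update β.g e₁ (a • β.g e₁ + b • β.g e₂) i v) •
          Function.update (Function.update β.w e₁ (a⁻¹ • β.w e₁)) e₂ (β.w e₂ - (b * a⁻¹) • β.w e₁) i =
        ∑ i ∈ (Finset.univ.erase e₁).erase e₂, (β.f i u * β.g i v) • β.w i := by
      refine Finset.sum_congr rfl fun i hi => ?_
      have hi₂ : i ≠ e₂ := (Finset.mem_erase.mp hi).1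
      have hi₁ : i ≠ e₁ := (Finset.mem_erase.mp (Finset.mem_erase.mp hi).2).1
      simp [hi₁, hi₂]
    rw [htail, ← add_assoc, ← add_assoc]
    congr 1
    simp only [Function.update_self, Function.update_of_ne hne'.symm, Function.update_of_ne hne', LinearMap.add_apply,
      LinearMap.smul_apply, smul_eq_mul, ← hf']
    have : β.f e₁ u * (a * β.g e₁ v + b * β.g e₂ v) * a⁻¹ = β.f e₁ u * β.g e₁ v + (β.f e₁ u * β.g e₂ v) * (b * a⁻¹) := by
      field_simp
    rw [smul_sub, smul_smul, smul_smul, this, add_smul]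
    abel
  rcases hxy with hx | hy
  · obtain ⟨β', h1, h2, h3⟩ := key d₁ d₂ hne hf x y hx
    exact ⟨β', d₁, Or.inl rfl, h1, h2, h3⟩
  · obtain ⟨β', h1, h2, h3⟩ := key d₂ d₁ hne.symm hf.symm y x hy
    refine ⟨β', d₂, Or.inr rfl, h1, by rw [h2, add_comm], fun i hi₁ hi₂ => h3 i hi₂ hi₁⟩

/-- **The double-cell kill** (memo DEFLATION-g40 §7(c), any field). In a computation of `⟨2,2,n+1⟩` (`n+1 ≥ 8`, length `≤ 3(n+1)+3`)
take row planes `λ₀, λ₁, λ₂` and column planes `μ₁, μ₂, μ₃` (each with a 4-set of terms `R_v`, `C_μ` whose X-forms lie in the plane;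
`λ₀ ∦ λ₁`, `λ₀ ∦ λ₂`, `μ₂ ∦ μ₃`), a DOUBLE CELL `d₁ ≠ d₂ ∈ R₀ ∩ C₃` with equal X-forms, single neighbours `t₁ ∈ R₀ ∩ C₁`, `t₂ ∈ R₀ ∩ C₂` in
its row and `s₁ ∈ C₃ ∩ R₁`, `s₂ ∈ C₃ ∩ R₂` in its column (with the off-plane memberships listed). Then, after recombining the double cell,
an admissible `(c, ν)`-deflation kills `t₁`, one of `d₁, d₂` and one of `s₁, s₂`: there is a computation of `⟨2,2,n⟩` on
`|ι| − 3` indices whose X-forms are the original ones outside `J = {t₁, d, s}`. -/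
theorem exists_deflation [DecidableEq ι] (hn : 8 ≤ n + 1) (β : BilinComp (mulBilin k 2 2 (n + 1)) ι)
    (hι : Fintype.card ι ≤ 3 * (n + 1) + 3)
    (lam0 lam1 lam2 mu1 mu2 mu3 : Fin 2 → k) (hlam0 : lam0 ≠ 0) (hlam1 : lam1 ≠ 0) (hlam2 : lam2 ≠ 0) (hmu1 : mu1 ≠ 0)
    (hmu2 : mu2 ≠ 0) (hmu3 : mu3 ≠ 0)
    (hlam01 : ∀ a b : k, a • lam0 + b • lam1 = 0 → a = 0 ∧ b = 0) (hlam02 : ∀ a b : k, a • lam0 + b • lam2 = 0 → a = 0 ∧ b = 0)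
    (hmu23 : ∀ a b : k, a • mu2 + b • mu3 = 0 → a = 0 ∧ b = 0)
    (R0 R1 R2 C1 C2 C3 : Finset ι) (hR0c : R0.card = 4) (hR1c : R1.card = 4) (hR2c : R2.card = 4) (hC1c : C1.card = 4)
    (hC2c : C2.card = 4) (hC3c : C3.card = 4)
    (hR0 : ∀ i ∈ R0, Matrix.vecMul lam0 (xMarginal β i) = 0) (hR1 : ∀ i ∈ R1, Matrix.vecMul lam1 (xMarginal β i) = 0)
    (hR2 : ∀ i ∈ R2, Matrix.vecMul lam2 (xMarginal β i) = 0) (hC1 : ∀ i ∈ C1, Matrix.mulVec (xMarginal β i) mu1 = 0)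
    (hC2 : ∀ i ∈ C2, Matrix.mulVec (xMarginal β i) mu2 = 0) (hC3 : ∀ i ∈ C3, Matrix.mulVec (xMarginal β i) mu3 = 0)
    (t₁ t₂ d₁ d₂ s₁ s₂ : ι) (ht₁R0 : t₁ ∈ R0) (ht₁C1 : t₁ ∈ C1) (ht₁C2 : t₁ ∉ C2) (ht₁C3 : t₁ ∉ C3) (ht₂R0 : t₂ ∈ R0)
    (ht₂C2 : t₂ ∈ C2) (hd₁R0 : d₁ ∈ R0) (hd₂R0 : d₂ ∈ R0) (hd₁C3 : d₁ ∈ C3) (hd₂C3 : d₂ ∈ C3) (hd₁C2 : d₁ ∉ C2) (hd₂C2 : d₂ ∉ C2)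
    (hd : d₁ ≠ d₂) (hfd : β.f d₁ = β.f d₂) (hs₁C3 : s₁ ∈ C3) (hs₁R1 : s₁ ∈ R1) (hs₁R0 : s₁ ∉ R0) (hs₁R2 : s₁ ∉ R2) (hs₂C3 : s₂ ∈ C3)
    (hs₂R2 : s₂ ∈ R2) (hs₂R0 : s₂ ∉ R0) :
    ∃ (d s : ι), (d = d₁ ∨ d = d₂) ∧ (s = s₁ ∨ s = s₂) ∧
      ∃ (β' : BilinComp (mulBilin k 2 2 n) (Fin (Fintype.card ι - ({t₁, d, s} : Finset ι).card)))
        (e : Fin (Fintype.card ι - ({t₁, d, s} : Finset ι).card) → ι),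
        Function.Injective e ∧ (∀ a, e a ∉ ({t₁, d, s} : Finset ι)) ∧ ∀ a, β'.f a = β.f (e a) := by
  classical
  -- the six cheap planes
  obtain ⟨c0, hc0i, hc0ch, hc0r⟩ := CheapSpans.loadedRowPlane_structure hn β hι lam0 hlam0 R0 hR0c hR0
  obtain ⟨c1, hc1i, hc1ch, -⟩ := CheapSpans.loadedRowPlane_structure hn β hι lam1 hlam1 R1 hR1c hR1
  obtain ⟨c2, hc2i, hc2ch, -⟩ := CheapSpans.loadedRowPlane_structure hn β hι lam2 hlam2 R2 hR2c hR2
  obtain ⟨b1, hb1i, hb1ch, -⟩ := CheapSpans.loadedColPlane_structure hn β hι mu1 hmu1 C1 hC1c hC1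
  obtain ⟨b2, hb2i, hb2ch, -⟩ := CheapSpans.loadedColPlane_structure hn β hι mu2 hmu2 C2 hC2c hC2
  obtain ⟨b3, hb3i, hb3ch, hb3r⟩ := CheapSpans.loadedColPlane_structure hn β hι mu3 hmu3 C3 hC3c hC3
  set ν₀ : Fin 2 → k := ![-lam0 1, lam0 0] with hν₀def
  set ν₁ : Fin 2 → k := ![-lam1 1, lam1 0] with hν₁def
  set ν₂' : Fin 2 → k := ![-lam2 1, lam2 0] with hν₂'def
  set μ₁ : Fin 2 → k := ![-mu1 1, mu1 0] with hμ₁def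
  set μ₂ : Fin 2 → k := ![-mu2 1, mu2 0] with hμ₂def
  set μ₃ : Fin 2 → k := ![-mu3 1, mu3 0] with hμ₃def
  have hν₀ : ν₀ ≠ 0 := CheapSpans.nu_ne_zero lam0 hlam0
  have hν₁ : ν₁ ≠ 0 := CheapSpans.nu_ne_zero lam1 hlam1
  have hν₂' : ν₂' ≠ 0 := CheapSpans.nu_ne_zero lam2 hlam2
  have hμ₁ : μ₁ ≠ 0 := CheapSpans.nu_ne_zero mu1 hmu1
  have hμ₂ : μ₂ ≠ 0 := CheapSpans.nu_ne_zero mu2 hmu2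
  have hμ₃ : μ₃ ≠ 0 := CheapSpans.nu_ne_zero mu3 hmu3
  have hμ23 := nu_indep mu2 mu3 hmu23
  have hν02 := nu_indep lam0 lam2 hlam02
  have hν01 := nu_indep lam0 lam1 hlam01
  -- the rows of G_t in the c0-basis: `hc0r t ht κ : ∃ a, (fun j => β.g t (Matrix.single κ j (1 : k))) = ∑ a m • c0 m`
  have hc0r' : ∀ t, t ∈ R0 → ∀ κ, ∃ a : Fin 2 → k, (fun j => β.g t (Matrix.single κ j (1 : k))) = ∑ m, a m • c0 m := fun t ht κ => hc0r t ht κ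
  -- (1) the Gram block P03 is invertible
  set P03 : Matrix (Fin 2) (Fin 2) k := Matrix.of fun l m => c0 l ⬝ᵥ b3 m with hP03
  choose A₁ hA₁ using hc0r' d₁ hd₁R0
  choose A₂ hA₂ using hc0r' d₂ hd₂R0
  have hgd : ∀ (i : Fin 2) (m : Fin 2), β.g (if i = 0 then d₁ else d₂) (Matrix.vecMulVec μ₃ (b3 m)) =
      Matrix.vecMul (Matrix.vecMul μ₃ (Matrix.of fun κ l => (if i = 0 then A₁ else A₂) κ l)) P03 m := by
    intro i m
    fin_cases i
    · exact GramNondeg.g_cheapInput_eq_vecMul β d₁ c0 b3 μ₃ (Matrix.of fun κ l => A₁ κ l) (fun κ => hA₁ κ) m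
    · exact GramNondeg.g_cheapInput_eq_vecMul β d₂ c0 b3 μ₃ (Matrix.of fun κ l => A₂ κ l) (fun κ => hA₂ κ) m
  have hdet : P03.det ≠ 0 := by
    refine GramNondeg.det_ne_zero_of_independent_images P03 (Matrix.vecMul μ₃ (Matrix.of fun κ l => A₁ κ l))
      (Matrix.vecMul μ₃ (Matrix.of fun κ l => A₂ κ l)) fun a₁ a₂ hrel => ?_
    refine ColumnSubcomp.double_cell_independent β μ₃ hμ₃ C3 hC3c b3 hb3i hb3ch d₁ d₂ hd₁C3 hd₂C3 hd hfd a₁ a₂ fun m => ?_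
    have h1 := hgd 0 m
    have h2 := hgd 1 m
    simp only [if_true, show (1 : Fin 2) ≠ 0 from by decide, if_false] at h1 h2
    rw [h1, h2]; exact hrel m
  have hnondeg_c : ∀ a : Fin 2 → k, (∀ m, (∑ l, a l • c0 l) ⬝ᵥ b3 m = 0) → ∑ l, a l • c0 l = 0 :=
    fun a h => GramNondeg.c_combo_eq_zero_of_perp c0 b3 hdet a h
  have hnondeg_b : ∀ a : Fin 2 → k, (∀ m, (∑ l, a l • b3 l) ⬝ᵥ c0 m = 0) → ∑ l, a l • b3 l = 0 := by
    intro a h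
    refine GramNondeg.b_combo_eq_zero_of_perp c0 b3 hdet a fun l => ?_
    rw [dotProduct_comm]; exact h l
  -- (2) the shape of t₁: rank one on a line g ⊆ span(c0), g ⊥ b2
  have hcombo_t₁ : ∑ κ, μ₃ κ • (fun j => β.g t₁ (Matrix.single κ j (1 : k))) = 0 := by
    refine RankOneShapes.combo_eq_zero_of_nondeg c0 b3 ((fun κ j => β.g t₁ (Matrix.single κ j (1 : k)))) μ₃ (hc0r' t₁ ht₁R0) (fun m => ?_) hnondeg_c
    rw [← g_vecMulVec_eq_combo_dot]; exact hb3ch t₁ ht₁C3 m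
  obtain ⟨η, κ₀, hη⟩ := RankOneShapes.exists_rankOne_of_combo_eq_zero ((fun κ j => β.g t₁ (Matrix.single κ j (1 : k)))) μ₃ hμ₃ hcombo_t₁
  set g : Fin (n + 1) → k := (fun j => β.g t₁ (Matrix.single κ₀ j (1 : k))) with hgdef
  have hGt₁ : ∀ Y, β.g t₁ Y = ∑ q, ∑ j, η q * g j * Y q j := by
    intro Y; rw [g_eq_sum_rows]
    exact Finset.sum_congr rfl fun q _ => Finset.sum_congr rfl fun j _ => by rw [hη q, Pi.smul_apply, smul_eq_mul]
  have hg0 : g ≠ 0 := by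
    intro hg
    obtain ⟨m, hm⟩ := ColumnSubcomp.sees_cheap_input β μ₁ hμ₁ C1 hC1c b1 hb1i hb1ch t₁ ht₁C1
    apply hm
    rw [hGt₁]
    simp [hg]
  have hμ₃η : μ₃ ⬝ᵥ η = 0 := by
    have h : (μ₃ ⬝ᵥ η) • g = 0 := by
      rw [← hcombo_t₁, dotProduct, Finset.sum_smul]
      exact Finset.sum_congr rfl fun κ _ => by rw [hη κ, smul_smul]
    exact (smul_eq_zero.mp h).resolve_right hg0
  have hμ₂η : μ₂ ⬝ᵥ η ≠ 0 := by
    intro h0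
    have := eq_zero_of_perp_indep μ₂ μ₃ η hμ23 h0 hμ₃η
    apply hg0
    rw [hgdef, hη κ₀, this, Pi.zero_apply, zero_smul]
  have hg_b2 : ∀ m, g ⬝ᵥ b2 m = 0 := by
    intro m
    have h := hb2ch t₁ ht₁C2 m
    rw [g_vecMulVec_eq_combo_dot] at h
    have e : ∑ κ, μ₂ κ • (fun j => β.g t₁ (Matrix.single κ j (1 : k))) = (μ₂ ⬝ᵥ η) • g := by
      rw [dotProduct, Finset.sum_smul]
      exact Finset.sum_congr rfl fun κ _ => by rw [hη κ, smul_smul]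
    rw [e, smul_dotProduct, smul_eq_mul] at h
    exact (mul_eq_zero.mp h).resolve_left hμ₂η
  -- (3) some c0 l pairs non-trivially with some b2 m₀ (via t₂)
  obtain ⟨m₀, hm₀⟩ : ∃ m₀, c0 0 ⬝ᵥ b2 m₀ ≠ 0 ∨ c0 1 ⬝ᵥ b2 m₀ ≠ 0 := by
    obtain ⟨m₀, hm⟩ := ColumnSubcomp.sees_cheap_input β μ₂ hμ₂ C2 hC2c b2 hb2i hb2ch t₂ ht₂C2
    refine ⟨m₀, ?_⟩
    by_contra hno
    push Not at hno
    apply hm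
    rw [g_vecMulVec_eq_combo_dot, sum_dotProduct]
    refine Finset.sum_eq_zero fun κ _ => ?_
    obtain ⟨a, ha⟩ := hc0r' t₂ ht₂R0 κ
    rw [smul_dotProduct, ha, sum_dotProduct, Fin.sum_univ_two, smul_dotProduct, smul_dotProduct, hno.1, hno.2]
    simp
  -- (4) g in coordinates
  obtain ⟨p₀, hp₀⟩ := hc0r' t₁ ht₁R0 κ₀
  have hp₀' : p₀ ≠ 0 := by
    intro h; apply hg0; rw [hgdef, hp₀, h]; simp
  have hg_b2' : ∀ m, (∑ l, p₀ l • c0 l) ⬝ᵥ b2 m = 0 := fun m => by rw [← hp₀]; exact hg_b2 m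
  -- (5) recombination data on the double cell
  obtain ⟨x, y, hxy, η'', hη''⟩ := RankOneShapes.exists_recombination_on_line c0 b2 μ₂ hμ₂ ((fun κ j => β.g d₁ (Matrix.single κ j (1 : k)))) ((fun κ j => β.g d₂ (Matrix.single κ j (1 : k))))
    (hc0r' d₁ hd₁R0) (hc0r' d₂ hd₂R0)
    (fun m => by rw [← g_vecMulVec_eq_combo_dot]; exact hb2ch d₁ hd₁C2 m)
    (fun m => by rw [← g_vecMulVec_eq_combo_dot]; exact hb2ch d₂ hd₂C2 m) p₀ hp₀' hg_b2' m₀ hm₀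
  -- (6) recombine
  obtain ⟨β₁, d, hdd, hf₁, hg₁d, hrest⟩ := exists_recombine β d₁ d₂ hd hfd x y hxy
  have hGd : ∀ Y, β₁.g d Y = ∑ q, ∑ j, η'' q * g j * Y q j := by
    intro Y
    rw [hg₁d, LinearMap.add_apply, LinearMap.smul_apply, LinearMap.smul_apply, g_eq_sum_rows, g_eq_sum_rows, smul_eq_mul,
      smul_eq_mul, Finset.mul_sum, Finset.mul_sum, ← Finset.sum_add_distrib]
    refine Finset.sum_congr rfl fun q _ => ?_
    rw [Finset.mul_sum, Finset.mul_sum, ← Finset.sum_add_distrib]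
    refine Finset.sum_congr rfl fun j _ => ?_
    have h := congrFun (hη'' q) j
    simp only [Pi.add_apply, Pi.smul_apply, smul_eq_mul] at h
    rw [← hp₀] at h
    linear_combination Y q j * h
  -- (7) W-side shapes of s₁ and s₂ in the recombined computation (their data is unchanged)
  have hs₁d : s₁ ≠ d₁ ∧ s₁ ≠ d₂ := ⟨fun h => hs₁R0 (h ▸ hd₁R0), fun h => hs₁R0 (h ▸ hd₂R0)⟩
  have hs₂d : s₂ ≠ d₁ ∧ s₂ ≠ d₂ := ⟨fun h => hs₂R0 (h ▸ hd₁R0), fun h => hs₂R0 (h ▸ hd₂R0)⟩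
  have ht₁d : t₁ ≠ d₁ ∧ t₁ ≠ d₂ := ⟨fun h => ht₁C3 (h ▸ hd₁C3), fun h => ht₁C3 (h ▸ hd₂C3)⟩
  -- generic W-shape: for s ∈ C3 \ R0: W_s = ω ⊗ h with ν₀ ⬝ᵥ ω = 0, h a row of W_s, h ∈ span(b3)
  have wshape : ∀ s, s ∈ C3 → s ∉ R0 →
      (∑ κ, ν₀ κ • β.w s κ = 0) ∧ ∃ (ω : Fin 2 → k) (κ₁ : Fin 2), ∀ κ, β.w s κ = ω κ • β.w s κ₁ := by
    intro s hsC3 hsR0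
    have hcombo : ∑ κ, ν₀ κ • β.w s κ = 0 := by
      refine RankOneShapes.combo_eq_zero_of_nondeg b3 c0 (β.w s) ν₀ (hb3r s hsC3) (fun m => ?_) hnondeg_b
      rw [← cheapOut_eq_combo_dot]; exact hc0ch s hsR0 m
    exact ⟨hcombo, RankOneShapes.exists_rankOne_of_combo_eq_zero (β.w s) ν₀ hν₀ hcombo⟩
  obtain ⟨hcombo₁, ω, κ₁, hω⟩ := wshape s₁ hs₁C3 hs₁R0
  obtain ⟨hcombo₂, ω', κ₂, hω'⟩ := wshape s₂ hs₂C3 hs₂R0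
  set h : Fin (n + 1) → k := β.w s₁ κ₁ with hhdef
  set h' : Fin (n + 1) → k := β.w s₂ κ₂ with hh'def
  -- nonvanishing: h ≠ 0, h' ≠ 0 (each term of a loaded row plane writes something cheap-visible)
  have hh0 : h ≠ 0 := by
    intro h0
    obtain ⟨m, hm⟩ := RowSubcomp.sees_cheap_output β ν₁ hν₁ R1 hR1c c1 hc1i hc1ch s₁ hs₁R1
    apply hm
    rw [cheapOut_eq_combo_dot]
    have : ∑ κ, ν₁ κ • β.w s₁ κ = 0 := Finset.sum_eq_zero fun κ _ => by rw [hω κ, h0, smul_zero, smul_zero]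
    rw [this, zero_dotProduct]
  have hh'0 : h' ≠ 0 := by
    intro h0
    obtain ⟨m, hm⟩ := RowSubcomp.sees_cheap_output β ν₂' hν₂' R2 hR2c c2 hc2i hc2ch s₂ hs₂R2
    apply hm
    rw [cheapOut_eq_combo_dot]
    have : ∑ κ, ν₂' κ • β.w s₂ κ = 0 := Finset.sum_eq_zero fun κ _ => by rw [hω' κ, h0, smul_zero, smul_zero]
    rw [this, zero_dotProduct]
  -- the ν-combinations: (∑ ν κ • W κ) = (ν ⬝ᵥ ω) • h
  have hcomb : ∀ (ν : Fin 2 → k), ∑ κ, ν κ • β.w s₁ κ = (ν ⬝ᵥ ω) • h := by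
    intro ν; rw [dotProduct, Finset.sum_smul]
    exact Finset.sum_congr rfl fun κ _ => by rw [hω κ, smul_smul]
  have hcomb' : ∀ (ν : Fin 2 → k), ∑ κ, ν κ • β.w s₂ κ = (ν ⬝ᵥ ω') • h' := by
    intro ν; rw [dotProduct, Finset.sum_smul]
    exact Finset.sum_congr rfl fun κ _ => by rw [hω' κ, smul_smul]
  have hν₀ω : ν₀ ⬝ᵥ ω = 0 := by
    have e := hcomb ν₀; rw [hcombo₁] at e
    exact ((smul_eq_zero.mp e.symm).resolve_right hh0)
  have hν₀ω' : ν₀ ⬝ᵥ ω' = 0 := by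
    have e := hcomb' ν₀; rw [hcombo₂] at e
    exact ((smul_eq_zero.mp e.symm).resolve_right hh'0)
  have hν₂ω : ν₂' ⬝ᵥ ω ≠ 0 := by
    intro h0
    have := eq_zero_of_perp_indep ν₀ ν₂' ω hν02 hν₀ω h0
    apply hh0
    rw [hhdef, hω κ₁, this, Pi.zero_apply, zero_smul]
  have hν₂ω' : ν₂' ⬝ᵥ ω' ≠ 0 := by
    intro h0
    have := eq_zero_of_perp_indep ν₀ ν₂' ω' hν02 hν₀ω' h0
    apply hh'0
    rw [hh'def, hω' κ₂, this, Pi.zero_apply, zero_smul]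
  -- h ⊥ c2 (s₁ is cheap for row 2), and h' is NOT ⊥ c2 (s₂ writes in row 2)
  have hh_c2 : ∀ m, h ⬝ᵥ c2 m = 0 := by
    intro m
    have e := hc2ch s₁ hs₁R2 m
    rw [cheapOut_eq_combo_dot, hcomb, smul_dotProduct, smul_eq_mul] at e
    exact (mul_eq_zero.mp e).resolve_left hν₂ω
  obtain ⟨m₁, hm₁⟩ : ∃ m₁, h' ⬝ᵥ c2 m₁ ≠ 0 := by
    obtain ⟨m₁, hm⟩ := RowSubcomp.sees_cheap_output β ν₂' hν₂' R2 hR2c c2 hc2i hc2ch s₂ hs₂R2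
    refine ⟨m₁, fun h0 => hm ?_⟩
    rw [cheapOut_eq_combo_dot, hcomb', smul_dotProduct, h0, smul_zero]
  -- (8) admissibility: g ⬝ᵥ h ≠ 0 or g ⬝ᵥ h' ≠ 0
  have hadm : g ⬝ᵥ h ≠ 0 ∨ g ⬝ᵥ h' ≠ 0 := by
    by_contra hno
    push Not at hno
    obtain ⟨e1, e2⟩ := hno
    obtain ⟨α, hα⟩ := hb3r s₁ hs₁C3 κ₁
    obtain ⟨α', hα'⟩ := hb3r s₂ hs₂C3 κ₂
    -- v := (g ⬝ᵥ b3 m)_m is orthogonal to α and α'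
    have hv : α ⬝ᵥ (fun m => g ⬝ᵥ b3 m) = 0 := by
      rw [← e1, hhdef, hα, dotProduct_sum, dotProduct]
      exact Finset.sum_congr rfl fun m _ => by rw [dotProduct_smul, smul_eq_mul]
    have hv' : α' ⬝ᵥ (fun m => g ⬝ᵥ b3 m) = 0 := by
      rw [← e2, hh'def, hα', dotProduct_sum, dotProduct]
      exact Finset.sum_congr rfl fun m _ => by rw [dotProduct_smul, smul_eq_mul]
    by_cases hv0 : (fun m => g ⬝ᵥ b3 m) = 0
    · -- then g ⊥ span(b3), so g = 0 by non-degeneracy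
      apply hg0
      rw [hgdef, hp₀]
      refine hnondeg_c p₀ fun m => ?_
      rw [← hp₀]
      exact congrFun hv0 m
    · obtain ⟨a₁, a₂, hne, hrel⟩ := GramNondeg.exists_combo_of_perp _ α α' hv0 hv hv'
      -- a₁ h + a₂ h' = 0, pairing with c2 m₁ forces a₂ = 0, then a₁ = 0 (h ≠ 0): contradiction
      have hlin : a₁ • h + a₂ • h' = 0 := by
        rw [hhdef, hh'def, hα, hα', Finset.smul_sum, Finset.smul_sum, ← Finset.sum_add_distrib]
        refine Finset.sum_eq_zero fun m _ => ?_
        rw [smul_smul, smul_smul, ← add_smul, hrel m, zero_smul]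
      have ha₂ : a₂ = 0 := by
        have e := congrArg (fun v => v ⬝ᵥ c2 m₁) hlin
        simp only [add_dotProduct, smul_dotProduct, smul_eq_mul, hh_c2 m₁, mul_zero, zero_add, zero_dotProduct] at e
        exact (mul_eq_zero.mp e).resolve_right hm₁
      have ha₁ : a₁ = 0 := by
        rw [ha₂, zero_smul, add_zero] at hlin
        exact (smul_eq_zero.mp hlin).resolve_right hh0
      rcases hne with hh | hh
      · exact hh ha₁
      · exact hh ha₂
  -- (9) the kill: choose the single term of column 3 whose line is admissible with g
  have hWt : ∀ s (ωs : Fin 2 → k) (κs : Fin 2), (∀ κ, β.w s κ = ωs κ • β.w s κs) → s ≠ d₁ → s ≠ d₂ →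
      ∃ ω₀ : Fin 2 → k, ∀ p j, β₁.w s p j = ω₀ p * β.w s κs j := by
    intro s ωs κs hs hsd₁ hsd₂
    refine ⟨ωs, fun p j => ?_⟩
    rw [(hrest s hsd₁ hsd₂).2, hs p, Pi.smul_apply, smul_eq_mul]
  have hGt₁' : ∀ Y, β₁.g t₁ Y = ∑ q, ∑ j, η q * g j * Y q j := by
    intro Y; rw [(hrest t₁ ht₁d.1 ht₁d.2).1]; exact hGt₁ Y
  have hdt : d ≠ t₁ := by rcases hdd with rfl | rfl; exacts [ht₁d.1.symm, ht₁d.2.symm]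
  have main : ∀ (s : ι) (hh : Fin (n + 1) → k), (s = s₁ ∨ s = s₂) → s ≠ d₁ → s ≠ d₂ → hh ⬝ᵥ g ≠ 0 →
      (∃ ω₀ : Fin 2 → k, ∀ p j, β₁.w s p j = ω₀ p * hh j) →
      ∃ (d' s' : ι), (d' = d₁ ∨ d' = d₂) ∧ (s' = s₁ ∨ s' = s₂) ∧
        ∃ (β' : BilinComp (mulBilin k 2 2 n) (Fin (Fintype.card ι - ({t₁, d', s'} : Finset ι).card)))
          (e : Fin (Fintype.card ι - ({t₁, d', s'} : Finset ι).card) → ι),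
          Function.Injective e ∧ (∀ a, e a ∉ ({t₁, d', s'} : Finset ι)) ∧ ∀ a, β'.f a = β.f (e a) := by
    intro s hh hs hsd₁ hsd₂ hadm' hw
    refine ⟨d, s, hdd, hs, ?_⟩
    obtain ⟨β', e, he, heJ, hf', -⟩ := Deflation.exists_shorter_of_pair β₁ g hh hadm' ({t₁, d, s} : Finset ι)
      (fun i hi => by
        simp only [Finset.mem_insert, Finset.mem_singleton] at hi
        rcases hi with rfl | rfl | rfl
        · exact Or.inl ⟨η, hGt₁'⟩
        · exact Or.inl ⟨η'', hGd⟩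
        · exact Or.inr hw)
    exact ⟨β', e, he, heJ, fun a => by rw [hf', hf₁]⟩
  rcases hadm with h1 | h2
  · exact main s₁ h (Or.inl rfl) hs₁d.1 hs₁d.2 (by rwa [dotProduct_comm]) (hWt s₁ ω κ₁ hω hs₁d.1 hs₁d.2)
  · exact main s₂ h' (Or.inr rfl) hs₂d.1 hs₂d.2 (by rwa [dotProduct_comm]) (hWt s₂ ω' κ₂ hω' hs₂d.1 hs₂d.2)

end DoubleCellKill

end Summit.MatrixMultiplication.OmegaCensus.SmallFormats
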